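import Summits.PneNP.PneNP.Theorems.ConvexRankGatesLinAlgGateBlindTermCollapse
import Summits.PneNP.PneNP.Theorems.ConvexRankGatesLinAlgGateBlindPluckingBound
import Summits.PneNP.PneNP.Theorems.ConvexRankGatesLinAlgGateBlindWideApproxHost
import Summits.PneNP.PneNP.Theorems.ConvexRankGatesLinAlgGateBlindDenseRegime
import Summits.PneNP.PneNP.Theorems.ConvexRankGatesLinAlgGateBlindReduction

/-!
# Route ConvexRankGates, crux `LinAlgGateBlind` (stmt-PneNP-10681): the DOOR THEOREM — every wide-gate class that collapses to an SG term-gate class is blind to `CLIQUE(m, ⌈m^{1/8}⌉)`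

Support theorem for the crux (line `dnf-invariant-wide-gates-see-small-cliques`; vocabulary of
`Theorems/ConvexRankGatesLinAlgGateBlindDefs.lean`). The reduction `linAlgGateBlind_of_sgAt`
(`…Theorems.ConvexRankGatesLinAlgGateBlindReduction`) feeds the Alon–Boppana host `stub_wideApproxHost` with the crux's own
basis. The host, the plucking bound, the trimming count and the dense-regime budgets are all theorems about an ARBITRARY
set `W` of monotone wide gates; the only class-specific inputs are (a) a TERM COLLAPSE `W ∘ OR-of-atoms ⊆ term gates of P`
and (b) the single-gate statement `SGAt m P (lOf m) (kOf m) (qOf m) (epsOf c m)`. This file packages that once: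

* `not_computes_clique_of_collapse` — for every `c`, eventually in `m`: for every set `W` of monotone gates and every
  term-gate class `P` with (a) and (b), NO circuit over `{∧₂, ∨₂} ∪ W` with `≤ m^c` gates computes `CLIQUE(m, ⌈m^{1/8}⌉)`;
* term collapses (a) for the classes whose `SGAt` ranges are in the tree, all by rewiring along the atoms of the children
  (`acceptsB_eq_true_iff_exists_atom`, `image_rewire_eq` of `…TermCollapse`): `isTermGate_commPerm_collapse`
  (commutative `PERM_d`, the class of `sgAt_commPerm_of_fewPoints`), `isTermGate_permOrder_collapse` (permutation gates of
  group order `≤ M`, the class of `sgAt_permOrder_of_logb_le_rpow`), `isTermGate_spanGate_collapse` (span programs of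
  dimension `D` over a ring `F`, the class of `sgAt_spanGate_of_dim_le` / `sgAt_spanGateOver_of_dim_le_rpow`); the `PERM_d` /
  `GRANK_d` collapses are `stub_termCollapse`.

Each landed `SGAt` range thus becomes an UNCONDITIONAL lower bound for monotone circuits with the corresponding wide gates
(instances in `…Theorems.ConvexRankGatesLinAlgGateBlindPermCircuitLowerBound` and its successors). Sources: Razborov
1985, Alon–Boppana 1987 §3; host and planting are the tree's. No new definitions. [folklore]
-/

-- `Summit.PneNP.PneNP.…` duplicates `PneNP` BY DESIGN (single-problem summit).
set_option linter.dupNamespace false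

noncomputable section

namespace Summit.PneNP.PneNP.Theorems

open Finset Filter Literature.Computability.Complexity Razborov
open Summit.PneNP.PneNP.Cruxes.LinAlgGateBlind.DnfInvariantWideGatesSeeSmallCliques

/-! ### The door theorem -/

/-- **The door theorem.** For every `c`, eventually in `m`: let `W` be any set of MONOTONE gates and `P` any class of term
gates such that (a) every `g ∈ W` fed with small-clique DNFs `⌈A_i⌉`, `A_i ⊆ 𝒱(lOf m)`, is a term gate of class `P` over
`≤ lOf m`-atoms, and (b) `SGAt m P (lOf m) (kOf m) (qOf m) (epsOf c m)`. Then no circuit over `{∧₂, ∨₂} ∪ W` with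
`≤ m^c` gates computes `CLIQUE(m, ⌈m^{1/8}⌉)`. Proof: the host `stub_wideApproxHost` in `K(m, rOf c m, lOf m)` with
`t = m^c`, `εP = ε = epsOf c m`, `εN = 2ε`; `∨` = plucking (`stub_pluckingBound`), `∧` = trimming (`card_errPos_le_wide`),
both within the budgets of `stub_denseRegime`; a gate of `W` over closed children collapses by (a), is approximated by (b),
and the approximator is re-closed at plucking cost `≤ ε` (`lostPos_anti'`, `gainedNeg_le_add'`); endgame `m^c ε ≤ 1/16`, `2 m^c ε + Pr[clique] < 1/2 ≤ q^{C(l,2)}`.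
[folklore] -/
theorem not_computes_clique_of_collapse : ∀ c : ℕ, ∀ᶠ m : ℕ in atTop,
    ∀ (W : Set GateFn) (P : GateFn → Prop), (∀ g ∈ W, Monotone g.2) →
    (∀ g ∈ W, ∀ A : Fin g.1 → Finset (Finset (Fin m)), (∀ i, A i ⊆ smallSets (Fin m) (lOf m)) →
        IsTermGate m P (lOf m) (fun x => g.2 fun i => acceptsB (A i) x)) →
    SGAt m P (lOf m) (kOf m) (qOf m) (epsOf c m) →
    ∀ C : Circuit (KEdge m), C.IsOver ({GateFn.and 2, GateFn.or 2} ∪ W) →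
      C.size ≤ m ^ c → ¬ C.Computes (cliqueFn m ⌈(m : ℝ) ^ (1 / 8 : ℝ)⌉₊) := by
  intro c
  filter_upwards [stub_denseRegime c] with m hR W P hmono hcollapse hSG C hC hsize
  obtain ⟨hl, hr, hkm, hq0, hq1, hpl, hand, heps, hclq, hhalf⟩ := hR
  have hε : 0 ≤ epsOf c m := epsOf_nonneg c m
  refine stub_wideApproxHost m (kOf m) (rOf c m) (lOf m) (m ^ c) (qOf m) (epsOf c m) (2 * epsOf c m)
    W hr hl hkm hq0 hq1 hε (mul_nonneg (by norm_num) hε) hmono ?_ ?_ ?_ ?_ ?_ C hC hsize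
  · -- (∨): plucking within budget
    intro A B hA hB
    calc prob (qOf m) (fun x : KEdge m → Bool =>
          Accepts (closure (rOf c m) (lOf m) (A ∪ B)) x ∧ ¬ Accepts (A ∪ B) x)
        ≤ (#(smallSets (Fin m) (lOf m)) : ℝ) * (1 - qOf m ^ ((lOf m).choose 2)) ^ rOf c m :=
          stub_pluckingBound m (rOf c m) (lOf m) (qOf m) hq0 hq1 (A ∪ B) (union_subset hA.subset hB.subset)
      _ ≤ epsOf c m := hpl
      _ ≤ 2 * epsOf c m := by linarith
  · -- (∧): trimming count within budget
    intro A B hA hB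
    calc (#(errPos (kOf m) A B) : ℝ)
        ≤ ((((rOf c m - 1) ^ lOf m) ^ 2 * (m - (lOf m + 1)).choose (kOf m - (lOf m + 1)) : ℕ) : ℝ) := by
          exact_mod_cast card_errPos_le_wide hr hA hB
      _ ≤ epsOf c m * (m.choose (kOf m) : ℝ) := hand
  · -- gates of `W`: collapse (a), approximate (b), re-close
    intro g hg A hA
    have hsub : ∀ i, A i ⊆ smallSets (Fin m) (lOf m) := fun i => (hA i).subset
    obtain ⟨𝒜, h𝒜, hlost, hgain⟩ := hSG _ (hcollapse g hg A hsub)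
    refine ⟨closure (rOf c m) (lOf m) 𝒜, isClosedFamily_closure _ _ _, ?_, ?_⟩
    · calc (#(lostPos m (kOf m) (fun x => g.2 fun i => acceptsB (A i) x)
            (closure (rOf c m) (lOf m) 𝒜)) : ℝ)
          ≤ (#(lostPos m (kOf m) (fun x => g.2 fun i => acceptsB (A i) x) 𝒜) : ℝ) := by
            exact_mod_cast card_le_card (lostPos_anti' _ (subset_closure h𝒜))
        _ ≤ epsOf c m * (m.choose (kOf m) : ℝ) := hlost
    · calc gainedNeg m (qOf m) (fun x => g.2 fun i => acceptsB (A i) x) (closure (rOf c m) (lOf m) 𝒜)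
          ≤ gainedNeg m (qOf m) (fun x => g.2 fun i => acceptsB (A i) x) 𝒜 +
              prob (qOf m) (fun x : KEdge m → Bool =>
                Accepts (closure (rOf c m) (lOf m) 𝒜) x ∧ ¬ Accepts 𝒜 x) :=
            gainedNeg_le_add' hq0 hq1 _ _ _
        _ ≤ epsOf c m + (#(smallSets (Fin m) (lOf m)) : ℝ) * (1 - qOf m ^ ((lOf m).choose 2)) ^ rOf c m :=
            add_le_add hgain (stub_pluckingBound m (rOf c m) (lOf m) (qOf m) hq0 hq1 𝒜 h𝒜)
        _ ≤ 2 * epsOf c m := by linarith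
  · -- positive-side endgame budget
    exact lt_of_le_of_lt heps (by norm_num)
  · -- negative-side endgame budget
    have h2 : ((m ^ c : ℕ) : ℝ) * (2 * epsOf c m) = 2 * (((m ^ c : ℕ) : ℝ) * epsOf c m) := by ring
    rw [h2]
    linarith

/-- **The door theorem, single-gate-statement form.** If `W` collapses into `P` (eventually, at the line's `lOf`) and `P`
satisfies the single-gate statement at every level `c`, then `W`-circuits of polynomial size are blind to
`CLIQUE(m, ⌈m^{1/8}⌉)`: the PERM/GRANK-free half of `linAlgGateBlind_of_sgAt` for an arbitrary class. [folklore] -/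
theorem not_computes_clique_of_sgAt : ∀ (W : ℕ → Set GateFn) (P : ℕ → GateFn → Prop),
    (∀ m, ∀ g ∈ W m, Monotone g.2) →
    (∀ m l, ∀ g ∈ W m, ∀ A : Fin g.1 → Finset (Finset (Fin m)),
      (∀ i, A i ⊆ smallSets (Fin m) l) → IsTermGate m (P m) l (fun x => g.2 fun i => acceptsB (A i) x)) →
    (∀ c : ℕ, ∀ᶠ m : ℕ in atTop, SGAt m (P m) (lOf m) (kOf m) (qOf m) (epsOf c m)) → ∀ c : ℕ,
    ∀ᶠ m : ℕ in atTop, ∀ C : Circuit (KEdge m), C.IsOver ({GateFn.and 2, GateFn.or 2} ∪ W m) →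
      C.size ≤ m ^ c → ¬ C.Computes (cliqueFn m ⌈(m : ℝ) ^ (1 / 8 : ℝ)⌉₊) := by
  intro W P hmono hcollapse hSG c
  filter_upwards [not_computes_clique_of_collapse c, hSG c] with m hm hP
  exact hm (W m) (P m) (hmono m) (fun g hg A hA => hcollapse m (lOf m) g hg A hA) hP

/-! ### Term collapses by rewiring -/

/-- **Commutative `PERM_d` gates collapse to commutative `PERM_d` term gates**: repeat the generator `σ_i` on every new
wire `(i, X)`, `X ∈ A_i` (the repeated generators still commute; same `τ`, same points). [folklore] -/
theorem isTermGate_commPerm_collapse (m l d : ℕ) (g : GateFn) (A : Fin g.1 → Finset (Finset (Fin m)))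
    (hA : ∀ i, A i ⊆ smallSets (Fin m) l)
    (hg : ∃ d', d' ≤ d ∧ ∃ (σ : Fin g.1 → Equiv.Perm (Fin d')) (τ : Equiv.Perm (Fin d')),
      (∀ i j, σ i * σ j = σ j * σ i) ∧ ∀ v, g.2 v = true ↔ τ ∈ Subgroup.closure (σ '' {i | v i = true})) :
    IsTermGate m (fun g' => ∃ d', d' ≤ d ∧ ∃ (σ : Fin g'.1 → Equiv.Perm (Fin d')) (τ : Equiv.Perm (Fin d')),
      (∀ i j, σ i * σ j = σ j * σ i) ∧ ∀ v, g'.2 v = true ↔ τ ∈ Subgroup.closure (σ '' {i | v i = true})) l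
      (fun x => g.2 fun i => acceptsB (A i) x) := by
  classical
  set e := Fintype.equivFin (Σ i : Fin g.1, {X // X ∈ A i}) with he
  have hkey := acceptsB_eq_true_iff_exists_atom A e
  obtain ⟨d', hd', σ, τ, hcomm, hσ⟩ := hg
  refine ⟨⟨_, fun w => decide (τ ∈ Subgroup.closure ((fun a => σ (e.symm a).1) '' {a | w a = true}))⟩,
    ⟨d', hd', fun a => σ (e.symm a).1, τ, fun a b => hcomm _ _, fun w => decide_eq_true_iff⟩,
    fun a => ((e.symm a).2 : Finset (Fin m)), fun a => hA _ (e.symm a).2.2, fun x => ?_⟩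
  change g.2 (fun i => acceptsB (A i) x) =
    decide (τ ∈ Subgroup.closure ((fun a => σ (e.symm a).1) '' {a | atomB ((e.symm a).2 : Finset (Fin m)) x = true}))
  rw [Bool.eq_iff_iff, hσ, decide_eq_true_iff, image_rewire_eq (fun a => (e.symm a).1) σ (hkey x)]

/-- **Permutation gates of group order `≤ M` collapse to term gates of group order `≤ M`**: the rewired generators
`σ_{π a}` generate a subgroup of `⟨σ_i : i⟩`. [folklore] -/
theorem isTermGate_permOrder_collapse (m l M : ℕ) (g : GateFn) (A : Fin g.1 → Finset (Finset (Fin m)))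
    (hA : ∀ i, A i ⊆ smallSets (Fin m) l)
    (hg : ∃ (d : ℕ) (σ : Fin g.1 → Equiv.Perm (Fin d)) (τ : Equiv.Perm (Fin d)),
      Nat.card (Subgroup.closure (Set.range σ)) ≤ M ∧
        ∀ v, g.2 v = true ↔ τ ∈ Subgroup.closure (σ '' {i | v i = true})) :
    IsTermGate m (fun g' => ∃ (d : ℕ) (σ : Fin g'.1 → Equiv.Perm (Fin d)) (τ : Equiv.Perm (Fin d)),
      Nat.card (Subgroup.closure (Set.range σ)) ≤ M ∧
        ∀ v, g'.2 v = true ↔ τ ∈ Subgroup.closure (σ '' {i | v i = true})) l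
      (fun x => g.2 fun i => acceptsB (A i) x) := by
  classical
  set e := Fintype.equivFin (Σ i : Fin g.1, {X // X ∈ A i}) with he
  have hkey := acceptsB_eq_true_iff_exists_atom A e
  obtain ⟨d, σ, τ, hM, hσ⟩ := hg
  have hle : Subgroup.closure (Set.range fun a => σ (e.symm a).1) ≤ Subgroup.closure (Set.range σ) :=
    Subgroup.closure_mono (by rintro _ ⟨a, rfl⟩; exact ⟨(e.symm a).1, rfl⟩)
  refine ⟨⟨_, fun w => decide (τ ∈ Subgroup.closure ((fun a => σ (e.symm a).1) '' {a | w a = true}))⟩,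
    ⟨d, fun a => σ (e.symm a).1, τ, (Subgroup.card_le_of_le hle).trans hM, fun w => decide_eq_true_iff⟩,
    fun a => ((e.symm a).2 : Finset (Fin m)), fun a => hA _ (e.symm a).2.2, fun x => ?_⟩
  change g.2 (fun i => acceptsB (A i) x) =
    decide (τ ∈ Subgroup.closure ((fun a => σ (e.symm a).1) '' {a | atomB ((e.symm a).2 : Finset (Fin m)) x = true}))
  rw [Bool.eq_iff_iff, hσ, decide_eq_true_iff, image_rewire_eq (fun a => (e.symm a).1) σ (hkey x)]

/-- **Span-program gates of dimension `D` over a ring `F` collapse to span-program term gates of dimension `D`**: repeat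
the row `r_i` on every new wire over `i` (same target). [folklore] -/
theorem isTermGate_spanGate_collapse {F : Type} [Ring F] (m l D : ℕ) (g : GateFn)
    (A : Fin g.1 → Finset (Finset (Fin m))) (hA : ∀ i, A i ⊆ smallSets (Fin m) l)
    (hg : ∃ (r : Fin g.1 → Fin D → F) (t : Fin D → F),
      ∀ v, g.2 v = true ↔ t ∈ Submodule.span F (r '' {i | v i = true})) :
    IsTermGate m (fun g' => ∃ (r : Fin g'.1 → Fin D → F) (t : Fin D → F),
      ∀ v, g'.2 v = true ↔ t ∈ Submodule.span F (r '' {i | v i = true})) l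
      (fun x => g.2 fun i => acceptsB (A i) x) := by
  classical
  set e := Fintype.equivFin (Σ i : Fin g.1, {X // X ∈ A i}) with he
  have hkey := acceptsB_eq_true_iff_exists_atom A e
  obtain ⟨r, t, hr⟩ := hg
  refine ⟨⟨_, fun w => decide (t ∈ Submodule.span F ((fun a => r (e.symm a).1) '' {a | w a = true}))⟩,
    ⟨fun a => r (e.symm a).1, t, fun w => decide_eq_true_iff⟩,
    fun a => ((e.symm a).2 : Finset (Fin m)), fun a => hA _ (e.symm a).2.2, fun x => ?_⟩
  change g.2 (fun i => acceptsB (A i) x) =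
    decide (t ∈ Submodule.span F ((fun a => r (e.symm a).1) '' {a | atomB ((e.symm a).2 : Finset (Fin m)) x = true}))
  rw [Bool.eq_iff_iff, hr, decide_eq_true_iff, image_rewire_eq (fun a => (e.symm a).1) r (hkey x)]

/-! ### Monotonicity of the three classes -/

/-- Subgroup-membership gates (any presentation `g.2 v ↔ τ ∈ ⟨σ '' live⟩`) are monotone. [folklore] -/
theorem monotone_of_closure_gate {d : ℕ} (g : GateFn) (σ : Fin g.1 → Equiv.Perm (Fin d)) (τ : Equiv.Perm (Fin d))
    (h : ∀ v, g.2 v = true ↔ τ ∈ Subgroup.closure (σ '' {i | v i = true})) : Monotone g.2 := by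
  intro v w hvw
  rcases hv : g.2 v with _ | _
  · exact Bool.false_le _
  · rw [(h w).2 (Subgroup.closure_mono (Set.image_mono fun i (hi : v i = true) => ?_) ((h v).1 hv))]
    have := hvw i
    rw [hi] at this
    exact top_le_iff.1 this

/-- Span-membership gates (`g.2 v ↔ t ∈ span (r '' live)`) are monotone. [folklore] -/
theorem monotone_of_span_gate {F : Type} [Ring F] {D : ℕ} (g : GateFn) (r : Fin g.1 → Fin D → F) (t : Fin D → F)
    (h : ∀ v, g.2 v = true ↔ t ∈ Submodule.span F (r '' {i | v i = true})) : Monotone g.2 := by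
  intro v w hvw
  rcases hv : g.2 v with _ | _
  · exact Bool.false_le _
  · rw [(h w).2 (Submodule.span_mono (Set.image_mono fun i (hi : v i = true) => ?_) ((h v).1 hv))]
    have := hvw i
    rw [hi] at this
    exact top_le_iff.1 this

end Summit.PneNP.PneNP.Theorems

end
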